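import Summits.BirchSwinnertonDyer.BirchSwinnertonDyer.Theorems.ManinLocalTwoThreeDyadicUntwistTransport
import Summits.BirchSwinnertonDyer.BirchSwinnertonDyer.Theorems.ManinLocalTwoThreeOddUntwistReductions
import HarnessLib

/-!
# Route `ManinLocalTwoThree`, crux C3 `ManinPrimeToThreeAtNine` (stmt-BirchSwinnertonDyer-22968):
# **C3 ⟸ Manin at `3` on the GLOBALLY TWIST-MINIMAL classes** (no single-prime semistable untwist at all)

Final form of the reductions of seat bsd-line-manin23-p2 for C3. The birth stub `stub_twistMinimalAtThree`
(hence the crux, by the landed `maninLocalTwoThree_maninPrimeToThreeAtNine_of_twistMinimalAtThree`)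
follows from Manin's conjecture at `3` (mod the four printed facts) for the optimal curves with `9 ∣ N`
whose class admits NO semistable untwist at any single prime: not at `3` (`χ₋₃`), not at an odd `q ≠ 3`
with `q² ∣ N` (`χ_{q*}`), and not at `2` (`χ₋₄, χ₈, χ₋₈` with `4 ∣ N`, partner `4 ∤ N'` — ALL Stevens
cases, through `maninLocalTwoThree_not_dvd_maninConstant_of_dyadicUntwist_semistable`). Strong induction on
the level; ternary twist-minimality and `9 ∣ N` are inherited by every partner (the untwisting characters
are unramified at `3`). Supersedes `…_of_fullUntwistMinimal` (which excluded only the `η = 1` dyadic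
untwists). Nothing here proves BSD or Manin's conjecture. Seat bsd-line-manin23-p2.

References: [Stevens1989] Lemmas (5.2), (5.4), (5.6)–(5.7); [Cesnavicius2018] Thm. 1.2; [SilvermanATAEC1994] IV.9.4.
-/

set_option autoImplicit false
set_option linter.dupNamespace false

noncomputable section

open scoped Classical NumberField

namespace Summit.BirchSwinnertonDyer.BirchSwinnertonDyer.Theorems

open WeierstrassCurve IsDedekindDomain IsDedekindDomain.HeightOneSpectrum Rat.HeightOneSpectrum
  Literature.NumberTheory.Automorphic
  Literature.NumberTheory.EllipticCurves Literature.NumberTheory.EllipticCurves.ModularForms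

/-- **`stub_twistMinimalAtThree` ⟸ its GLOBALLY twist-minimal core**: the birth stub of C3 (verbatim as
the conclusion) follows from its restriction to the classes with no ternary, no odd (`q ≠ 3`, `q² ∣ N`)
and no dyadic (`4 ∣ N`, partner `4 ∤ N'`, any Stevens `η`) semistable untwist. Strong induction on the
level with the transport lemmas at `p = 3`. [cite: Stevens1989, Lemmas (5.2), (5.4), (5.6)–(5.7)]
[cite: SilvermanATAEC1994, IV.9.4] -/
theorem maninLocalTwoThree_twistMinimalAtThree_of_globallyTwistMinimal
    (H : Literature.NumberTheory.EllipticCurves.ModularForms.mazur_not_dvd_maninConstant_of_odd →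
      Literature.NumberTheory.EllipticCurves.ModularForms.abbesUllmo_not_dvd_maninConstant_of_not_dvd_level →
      Literature.NumberTheory.EllipticCurves.ModularForms.cesnavicius_not_two_dvd_maninConstant_of_two_dvd_level →
      Literature.NumberTheory.EllipticCurves.ModularForms.exists_isNewformOf →
      ∀ (W : WeierstrassCurve ℚ) [W.IsElliptic] [W.IsGloballyMinimal] {N : ℕ} [NeZero N]
        (D : ModularParametrizationData W N),
        (∀ z ∈ D.L.lattice, ∃ w ∈ periodLattice D.f, z = D.c * w) → 3 ^ 2 ∣ N →
        ¬ (∃ (W' : WeierstrassCurve ℚ) (d : ℤ), W'.IsElliptic ∧ W'.IsGloballyMinimal ∧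
          (d = -3) ∧ IsIsogenous W (W'.quadraticTwist (d : ℚ)) ∧
          ¬ 3 ^ 2 ∣ W'.conductorNorm ℤ) →
        ¬ (∃ (W' : WeierstrassCurve ℚ) (q : ℕ), W'.IsElliptic ∧ W'.IsGloballyMinimal ∧
          q.Prime ∧ q ≠ 2 ∧ q ≠ 3 ∧ q ^ 2 ∣ N ∧
          IsIsogenous W (W'.quadraticTwist (((-1 : ℤ) ^ (q / 2) * q : ℤ) : ℚ)) ∧
          ¬ q ^ 2 ∣ W'.conductorNorm ℤ) →
        ¬ (∃ (W' : WeierstrassCurve ℚ) (d : ℤ), W'.IsElliptic ∧ W'.IsGloballyMinimal ∧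
          (d = -1 ∨ d = 2 ∨ d = -2) ∧ 2 ^ 2 ∣ N ∧ IsIsogenous W (W'.quadraticTwist (d : ℚ)) ∧
          ¬ 2 ^ 2 ∣ W'.conductorNorm ℤ) →
        ¬ (3 : ℤ) ∣ D.maninConstant) :
    Literature.NumberTheory.EllipticCurves.ModularForms.mazur_not_dvd_maninConstant_of_odd →
    Literature.NumberTheory.EllipticCurves.ModularForms.abbesUllmo_not_dvd_maninConstant_of_not_dvd_level →
    Literature.NumberTheory.EllipticCurves.ModularForms.cesnavicius_not_two_dvd_maninConstant_of_two_dvd_level →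
    Literature.NumberTheory.EllipticCurves.ModularForms.exists_isNewformOf →
    ∀ (W : WeierstrassCurve ℚ) [W.IsElliptic] [W.IsGloballyMinimal] {N : ℕ} [NeZero N]
      (D : ModularParametrizationData W N),
      (∀ z ∈ D.L.lattice, ∃ w ∈ periodLattice D.f, z = D.c * w) → 3 ^ 2 ∣ N →
      ¬ (∃ (W' : WeierstrassCurve ℚ) (d : ℤ), W'.IsElliptic ∧ W'.IsGloballyMinimal ∧
        (d = -3) ∧ IsIsogenous W (W'.quadraticTwist (d : ℚ)) ∧
        ¬ 3 ^ 2 ∣ W'.conductorNorm ℤ) →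
      ¬ (3 : ℤ) ∣ D.maninConstant := by
  intro hM hAU hC2 hnf
  have hmod : nonempty_modularParametrizationData :=
    maninLocalTwoThree_nonempty_modularParametrizationData_of_exists_isNewformOf hnf
  -- ternary twist-minimality is inherited along any untwist unramified at `3`
  have inherit : ∀ {W W' W₁ V : WeierstrassCurve ℚ} [W.IsElliptic] [W'.IsElliptic] [W₁.IsElliptic]
      [V.IsElliptic] [V.IsGloballyMinimal] {e : ℤ} (he0 : (e : ℚ) ≠ 0)
      (hfe : ∀ (X : WeierstrassCurve ℚ) [X.IsElliptic],
        (X.quadraticTwist (e : ℚ)).conductorExponent ((primesEquiv (R := ℤ)).symm ⟨3, Nat.prime_three⟩) =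
          X.conductorExponent ((primesEquiv (R := ℤ)).symm ⟨3, Nat.prime_three⟩)),
      IsIsogenous W (W'.quadraticTwist (e : ℚ)) → IsIsogenous W' W₁ →
      IsIsogenous W₁ (V.quadraticTwist ((-3 : ℤ) : ℚ)) → ¬ 3 ^ 2 ∣ V.conductorNorm ℤ →
      ∃ (V₂ : WeierstrassCurve ℚ) (d : ℤ), V₂.IsElliptic ∧ V₂.IsGloballyMinimal ∧ (d = -3) ∧
        IsIsogenous W (V₂.quadraticTwist (d : ℚ)) ∧ ¬ 3 ^ 2 ∣ V₂.conductorNorm ℤ := by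
    intro W W' W₁ V _ _ _ _ _ e he0 hfe htw hiso₁ hisoV h9V
    have hdq : ((-3 : ℤ) : ℚ) ≠ 0 := by norm_num
    haveI : (V.quadraticTwist ((-3 : ℤ) : ℚ)).IsElliptic := V.isElliptic_quadraticTwist hdq
    haveI : (V.quadraticTwist (e : ℚ)).IsElliptic := V.isElliptic_quadraticTwist he0
    haveI : (W'.quadraticTwist (e : ℚ)).IsElliptic := W'.isElliptic_quadraticTwist he0
    obtain ⟨C, hCmin⟩ := hasGlobalMinimalModel_rat_holds (V.quadraticTwist (e : ℚ))
    haveI := hCmin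
    refine ⟨C • V.quadraticTwist (e : ℚ), -3, inferInstance, hCmin, rfl, ?_, ?_⟩
    · have h1 : IsIsogenous W' (V.quadraticTwist ((-3 : ℤ) : ℚ)) := hiso₁.trans' hisoV
      have h2 : IsIsogenous (W'.quadraticTwist (e : ℚ))
          ((V.quadraticTwist ((-3 : ℤ) : ℚ)).quadraticTwist (e : ℚ)) := h1.quadraticTwist he0
      rw [quadraticTwist_quadraticTwist, mul_comm ((-3 : ℤ) : ℚ) (e : ℚ),
        ← quadraticTwist_quadraticTwist] at h2
      have h3 : IsIsogenous ((V.quadraticTwist (e : ℚ)).quadraticTwist ((-3 : ℤ) : ℚ))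
          ((C • V.quadraticTwist (e : ℚ)).quadraticTwist ((-3 : ℤ) : ℚ)) := by
        rw [quadraticTwist_smul]; exact isIsogenous_smul _ _
      exact (htw.trans' h2).trans' h3
    · rw [conductorNorm_smul_rat]
      intro h9V₂
      apply h9V
      have e1 := factorization_conductorNorm_primesEquiv_symm V ⟨3, Nat.prime_three⟩
      have e2 := factorization_conductorNorm_primesEquiv_symm (V.quadraticTwist (e : ℚ)) ⟨3, Nat.prime_three⟩
      simp only at e1 e2
      refine (Nat.prime_three.pow_dvd_iff_le_factorization (conductorNorm_pos_holds V).ne').mpr ?_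
      rw [e1, ← hfe V, ← e2]
      exact (Nat.prime_three.pow_dvd_iff_le_factorization (conductorNorm_pos_holds _).ne').mp h9V₂
  -- `9 ∣ N(W')` is inherited along any untwist unramified at `3`
  have nine : ∀ {W W' : WeierstrassCurve ℚ} [W.IsElliptic] [W'.IsElliptic] {e : ℤ} (he0 : (e : ℚ) ≠ 0)
      (hfe : (W'.quadraticTwist (e : ℚ)).conductorExponent ((primesEquiv (R := ℤ)).symm ⟨3, Nat.prime_three⟩) =
          W'.conductorExponent ((primesEquiv (R := ℤ)).symm ⟨3, Nat.prime_three⟩)),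
      IsIsogenous W (W'.quadraticTwist (e : ℚ)) → 3 ^ 2 ∣ W.conductorNorm ℤ →
      3 ^ 2 ∣ W'.conductorNorm ℤ := by
    intro W W' _ _ e he0 hfe htw h9
    haveI : (W'.quadraticTwist (e : ℚ)).IsElliptic := W'.isElliptic_quadraticTwist he0
    have hWV : W.conductorNorm ℤ = (W'.quadraticTwist (e : ℚ)).conductorNorm ℤ :=
      conductorNorm_eq_of_isIsogenous_of_modularity hmod _ _ htw
    have h3W : 2 ≤ (W.conductorNorm ℤ).factorization 3 :=
      (Nat.prime_three.pow_dvd_iff_le_factorization (conductorNorm_pos_holds W).ne').mp h9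
    refine (Nat.prime_three.pow_dvd_iff_le_factorization (conductorNorm_pos_holds W').ne').mpr ?_
    have e1 := factorization_conductorNorm_primesEquiv_symm (W'.quadraticTwist (e : ℚ)) ⟨3, Nat.prime_three⟩
    have e2 := factorization_conductorNorm_primesEquiv_symm W' ⟨3, Nat.prime_three⟩
    simp only at e1 e2
    rw [e2, ← hfe, ← e1, ← hWV]
    exact h3W
  suffices key : ∀ (n : ℕ) (W : WeierstrassCurve ℚ) [W.IsElliptic] [W.IsGloballyMinimal] (N : ℕ)
      [NeZero N] (D : ModularParametrizationData W N), N < n →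
      (∀ z ∈ D.L.lattice, ∃ w ∈ periodLattice D.f, z = D.c * w) → 3 ^ 2 ∣ N →
      ¬ (∃ (W' : WeierstrassCurve ℚ) (d : ℤ), W'.IsElliptic ∧ W'.IsGloballyMinimal ∧
        (d = -3) ∧ IsIsogenous W (W'.quadraticTwist (d : ℚ)) ∧
        ¬ 3 ^ 2 ∣ W'.conductorNorm ℤ) →
      ¬ (3 : ℤ) ∣ D.maninConstant by
    intro W _ _ N _ D hopt h9 hmin
    exact key (N + 1) W N D (Nat.lt_succ_self N) hopt h9 hmin
  intro n
  induction n with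
  | zero => intro W _ _ N _ D hN; exact absurd hN (Nat.not_lt_zero N)
  | succ n ih =>
    intro W _ _ N _ D hNn hopt h9 hmin
    have hN : N = W.conductorNorm ℤ :=
      IsNewformOf.level_eq_conductorNorm_of_exists_isNewformOf hnf D.isNewformOf
    have h9W : 3 ^ 2 ∣ W.conductorNorm ℤ := hN ▸ h9
    by_cases hodd : ∃ (W' : WeierstrassCurve ℚ) (q : ℕ), W'.IsElliptic ∧ W'.IsGloballyMinimal ∧
        q.Prime ∧ q ≠ 2 ∧ q ≠ 3 ∧ q ^ 2 ∣ N ∧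
        IsIsogenous W (W'.quadraticTwist (((-1 : ℤ) ^ (q / 2) * q : ℤ) : ℚ)) ∧
        ¬ q ^ 2 ∣ W'.conductorNorm ℤ
    · obtain ⟨W', q, hE', hM', hqp, hq2, hq3, hqN, htw, hqN'⟩ := hodd
      haveI := hE'
      haveI := hM'
      haveI : Fact q.Prime := ⟨hqp⟩
      refine maninLocalTwoThree_not_dvd_maninConstant_of_oddUntwist hnf hq2 D hopt hqN htw hqN' ?_
      intro W₁ _ _ N₁ _ D₁ hiso₁ hopt₁
      have hd0 : ((((-1 : ℤ) ^ (q / 2) * q : ℤ)) : ℚ) ≠ 0 := by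
        push_cast
        exact mul_ne_zero (pow_ne_zero _ (by norm_num)) (by exact_mod_cast hqp.ne_zero)
      have hv3 : natGenerator ((primesEquiv (R := ℤ)).symm ⟨3, Nat.prime_three⟩) ≠ q := by
        rw [natGenerator_primesEquiv_symm Nat.prime_three]; exact fun h ↦ hq3 h.symm
      have hfe : ∀ (X : WeierstrassCurve ℚ) [X.IsElliptic],
          (X.quadraticTwist ((((-1 : ℤ) ^ (q / 2) * q : ℤ)) : ℚ)).conductorExponent
              ((primesEquiv (R := ℤ)).symm ⟨3, Nat.prime_three⟩) =
            X.conductorExponent ((primesEquiv (R := ℤ)).symm ⟨3, Nat.prime_three⟩) := by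
        intro X _
        haveI : (X.quadraticTwist (((-1 : ℤ) ^ (q / 2) * q : ℤ) : ℚ)).IsElliptic :=
          X.isElliptic_quadraticTwist hd0
        have hC1 : (1 : VariableChange ℚ) • X.quadraticTwist ((-1 : ℚ) ^ (q / 2) * q) =
            X.quadraticTwist (((-1 : ℤ) ^ (q / 2) * q : ℤ) : ℚ) := by
          rw [one_smul]; push_cast; rfl
        exact Summit.BirchSwinnertonDyer.Rank1Residual.Additive.conductorExponent_eq_of_twist_pStar_of_ne
          q hq2 X _ 1 hC1 _ hv3
      have hN₁ : N₁ = W'.conductorNorm ℤ := level_eq_conductorNorm_of_isIsogenous hnf D₁ hiso₁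
      have hadd : ¬ W.HasGoodReductionAtPrime q ∧ ¬ W.HasMultiplicativeReductionAtPrime q :=
        Summit.BirchSwinnertonDyer.Rank1Residual.ManinAdditive.not_good_and_not_mult_of_sq_dvd_conductorNorm
          W (hN ▸ hqN)
      have hN'N : W'.conductorNorm ℤ ∣ W.conductorNorm ℤ :=
        maninLocalTwoThree_conductorNorm_dvd_of_isIsogenous_twist_pStar hnf hq2 htw hqN' hadd
      have hlt : N₁ < N := by
        rw [hN₁, hN]
        refine lt_of_le_of_ne (Nat.le_of_dvd (conductorNorm_pos_holds W) hN'N) fun h ↦ hqN' ?_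
        rw [h]; exact hN ▸ hqN
      have h9₁ : 3 ^ 2 ∣ N₁ := hN₁ ▸ nine hd0 (hfe W') htw h9W
      refine ih W₁ N₁ D₁ (by omega) hopt₁ h9₁ ?_
      rintro ⟨V, d, hVe, hVm, rfl, hisoV, h9V⟩
      haveI := hVe
      haveI := hVm
      exact hmin (inherit hd0 hfe htw hiso₁ hisoV h9V)
    · by_cases hdy : ∃ (W' : WeierstrassCurve ℚ) (d : ℤ), W'.IsElliptic ∧ W'.IsGloballyMinimal ∧
          (d = -1 ∨ d = 2 ∨ d = -2) ∧ 2 ^ 2 ∣ N ∧ IsIsogenous W (W'.quadraticTwist (d : ℚ)) ∧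
          ¬ 2 ^ 2 ∣ W'.conductorNorm ℤ
      · obtain ⟨W', d, hE', hM', hd, h4, htw, h4N'⟩ := hdy
        haveI := hE'
        haveI := hM'
        haveI : Fact (Nat.Prime 2) := ⟨Nat.prime_two⟩
        refine maninLocalTwoThree_not_dvd_maninConstant_of_dyadicUntwist_semistable hnf D hopt h4 hd htw
          h4N' ?_
        intro W₁ _ _ N₁ _ D₁ hiso₁ hopt₁
        have hdne : d ≠ 0 := by rcases hd with rfl | rfl | rfl <;> norm_num
        have hd0 : (d : ℚ) ≠ 0 := by exact_mod_cast hdne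
        have hfe : ∀ (X : WeierstrassCurve ℚ) [X.IsElliptic],
            (X.quadraticTwist (d : ℚ)).conductorExponent ((primesEquiv (R := ℤ)).symm ⟨3, Nat.prime_three⟩) =
              X.conductorExponent ((primesEquiv (R := ℤ)).symm ⟨3, Nat.prime_three⟩) := fun X _ ↦
          maninLocalTwoThree_conductorExponent_quadraticTwist_eq_of_ne_two X hd _
            (by rw [natGenerator_primesEquiv_symm Nat.prime_three]; norm_num)
        have hN₁ : N₁ = W'.conductorNorm ℤ := level_eq_conductorNorm_of_isIsogenous hnf D₁ hiso₁
        have hadd : ¬ W.HasGoodReductionAtPrime 2 ∧ ¬ W.HasMultiplicativeReductionAtPrime 2 :=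
          Summit.BirchSwinnertonDyer.Rank1Residual.ManinAdditive.not_good_and_not_mult_of_sq_dvd_conductorNorm
            W (hN ▸ h4)
        have hN'N : W'.conductorNorm ℤ ∣ W.conductorNorm ℤ :=
          (stub_dyadicTwistConductor hnf hd htw h4N' hadd).1
        have hlt : N₁ < N := by
          rw [hN₁, hN]
          refine lt_of_le_of_ne (Nat.le_of_dvd (conductorNorm_pos_holds W) hN'N) fun h ↦ h4N' ?_
          rw [h]; exact hN ▸ h4
        have h9₁ : 3 ^ 2 ∣ N₁ := hN₁ ▸ nine hd0 (hfe W') htw h9W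
        refine ih W₁ N₁ D₁ (by omega) hopt₁ h9₁ ?_
        rintro ⟨V, d', hVe, hVm, rfl, hisoV, h9V⟩
        haveI := hVe
        haveI := hVm
        exact hmin (inherit hd0 hfe htw hiso₁ hisoV h9V)
      · exact H hM hAU hC2 hnf W D hopt h9 hmin hodd hdy

/-- **Crux C3 `ManinPrimeToThreeAtNine` ⟸ Manin at `3` on the globally twist-minimal classes** (one
hypothesis; mod the printed facts): optimal curves with `9 ∣ N` admitting no semistable untwist at any
single prime. [cite: Stevens1989, Lemmas (5.2), (5.4)] [cite: Cesnavicius2018, Thm. 1.2] -/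
theorem maninLocalTwoThree_maninPrimeToThreeAtNine_of_globallyTwistMinimal
    (H : Literature.NumberTheory.EllipticCurves.ModularForms.mazur_not_dvd_maninConstant_of_odd →
      Literature.NumberTheory.EllipticCurves.ModularForms.abbesUllmo_not_dvd_maninConstant_of_not_dvd_level →
      Literature.NumberTheory.EllipticCurves.ModularForms.cesnavicius_not_two_dvd_maninConstant_of_two_dvd_level →
      Literature.NumberTheory.EllipticCurves.ModularForms.exists_isNewformOf →
      ∀ (W : WeierstrassCurve ℚ) [W.IsElliptic] [W.IsGloballyMinimal] {N : ℕ} [NeZero N]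
        (D : ModularParametrizationData W N),
        (∀ z ∈ D.L.lattice, ∃ w ∈ periodLattice D.f, z = D.c * w) → 3 ^ 2 ∣ N →
        ¬ (∃ (W' : WeierstrassCurve ℚ) (d : ℤ), W'.IsElliptic ∧ W'.IsGloballyMinimal ∧
          (d = -3) ∧ IsIsogenous W (W'.quadraticTwist (d : ℚ)) ∧
          ¬ 3 ^ 2 ∣ W'.conductorNorm ℤ) →
        ¬ (∃ (W' : WeierstrassCurve ℚ) (q : ℕ), W'.IsElliptic ∧ W'.IsGloballyMinimal ∧
          q.Prime ∧ q ≠ 2 ∧ q ≠ 3 ∧ q ^ 2 ∣ N ∧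
          IsIsogenous W (W'.quadraticTwist (((-1 : ℤ) ^ (q / 2) * q : ℤ) : ℚ)) ∧
          ¬ q ^ 2 ∣ W'.conductorNorm ℤ) →
        ¬ (∃ (W' : WeierstrassCurve ℚ) (d : ℤ), W'.IsElliptic ∧ W'.IsGloballyMinimal ∧
          (d = -1 ∨ d = 2 ∨ d = -2) ∧ 2 ^ 2 ∣ N ∧ IsIsogenous W (W'.quadraticTwist (d : ℚ)) ∧
          ¬ 2 ^ 2 ∣ W'.conductorNorm ℤ) →
        ¬ (3 : ℤ) ∣ D.maninConstant) :
    Summit.BirchSwinnertonDyer.BirchSwinnertonDyer.Theses.ManinLocalTwoThree.ManinPrimeToThreeAtNine :=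
  maninLocalTwoThree_maninPrimeToThreeAtNine_of_twistMinimalAtThree
    (maninLocalTwoThree_twistMinimalAtThree_of_globallyTwistMinimal H)

end Summit.BirchSwinnertonDyer.BirchSwinnertonDyer.Theorems

end
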